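import Summits.HubbardSuperconductivity.HubbardSuperconductivity.Theorems.AnisotropyChordTransferFibre3GreenZeroBrackets

/-!
# Route `AnisotropyChord` / H0 rotor rung: the capacity brackets at `L ≥ 48` (near rows, far-row logarithm, trapezoid remainder)

Block `[48,64)` version of `…Fibre3GreenZeroBrackets` (p1 g26, stated for `L ≥ 64`): the SAME three numeric brackets with the `L ≥ 48` numerics
(`x = 4π/L ≤ 0.2618`, `x² ≤ 0.068539`): ★ `nearRow_bracket48` (generic in `ȳ ≥ (πp/48)²`), ★ `farLog_bracket48`:
`(1/4π)·log((1+√(1−s⁴))/s²) ∈ log L/(2π) + [−0.348041, −0.345825]`, ★ `farRemainder_bound48`: `≤ 0.001448`.  Inputs of the capacity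
constant at `L ≥ 48` (t-block `[48,64)` of the range `48 ≤ L < 128`, route-lead ruling R1; inventory memo HOME/hubbard-h0-rotor-p2/TBLOCK-INVENTORY-g8.md).
Prover seat `hubbard-h0-rotor-p2` g8; helper for stmt-HubbardSuperconductivity-23918 (`--supports`, helper class).
WHAT THIS IS NOT: nothing here proves superconductivity in the Hubbard model; numeric inputs (family A) of ONE conditional reduction on the blocks.
Tree + Literature imports; no new definitions; no sorry.
-/

set_option linter.dupNamespace false
set_option autoImplicit false

noncomputable section

open scoped BigOperators
open Real Finset

namespace Summit.HubbardSuperconductivity.HubbardSuperconductivity.Theorems.AnisotropyChord.Transfer.Fibre3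

namespace CapacityConst

variable (L : ℕ) [NeZero L]

/-- near/endpoint rows: `V_p ≤ ψ₀(2πp/L)/L ≤ U_p` for `p ≤ 4`, `L ≥ 64`, from `x_p² ≤ ȳ_p`. [folklore] -/
theorem nearRow_bracket48 (hL : 48 ≤ L) (p : ℕ) (hp : 0 < p) (hp4 : p ≤ 4) (ybar U V : ℝ)
    (hy : (3.141593 * p / 48) ^ 2 ≤ ybar) (hy6 : ybar < 6)
    (hU : 1 ≤ U * (4 * 3.141592 * p * (1 - ybar / 6))) (hV : V * (4 * 3.141593 * p * (1 + ybar / 2)) ≤ 1) :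
    V ≤ psiRow 0 (2 * Real.pi * p / L) / L ∧ psiRow 0 (2 * Real.pi * p / L) / L ≤ U := by
  have hπlo := Real.pi_gt_d6
  have hπhi := Real.pi_lt_d6
  have hL0 : (0 : ℝ) < L := by exact_mod_cast (show 0 < L by omega)
  have hL64 : (48 : ℝ) ≤ L := by exact_mod_cast hL
  have hp0 : (0 : ℝ) < p := by exact_mod_cast hp
  have hp4r : (p : ℝ) ≤ 4 := by exact_mod_cast hp4
  have hπp : Real.pi * p ≤ L := by nlinarith
  have hx1 : Real.pi * p / L ≤ 3.141593 * p / 48 := by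
    rw [div_le_div_iff₀ hL0 (by norm_num)]; nlinarith
  have hy' : (Real.pi * p / L) ^ 2 ≤ ybar := (pow_le_pow_left₀ (by positivity) hx1 2).trans hy
  have hy0 : 0 ≤ (Real.pi * p / L) ^ 2 := by positivity
  constructor
  · refine le_trans ?_ (psiRow_row_div_ge L p hp hπp)
    apply le_one_div_of _ (4 * 3.141593 * p * (1 + ybar / 2)) _ (by positivity) _ hV
    have h1 : 4 * Real.pi * p ≤ 4 * 3.141593 * p := by nlinarith
    have h2 : 1 + (Real.pi * p / L) ^ 2 / 2 ≤ 1 + ybar / 2 := by linarith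
    exact mul_le_mul h1 h2 (by positivity) (by positivity)
  · refine (psiRow_row_div_le_sharp L p hp hπp).trans ?_
    have hpos : 0 < 4 * 3.141592 * p * (1 - ybar / 6) := by
      have : 0 < 1 - ybar / 6 := by linarith
      positivity
    apply one_div_le_of _ (4 * 3.141592 * p * (1 - ybar / 6)) _ hpos _ hU
    have h1 : 4 * 3.141592 * p ≤ 4 * Real.pi * p := by nlinarith
    have h2 : 1 - ybar / 6 ≤ 1 - (Real.pi * p / L) ^ 2 / 6 := by linarith
    exact mul_le_mul h1 h2 (by linarith) (by positivity)
set_option maxHeartbeats 400000 in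
omit [NeZero L] in
/-- the far-row logarithm: `(1/4π)·log((1 + √(1−s⁴))/s²) ∈ log L/(2π) + [−0.3477850, −0.3466356]`, `s = sin(4π/L)`, `L ≥ 64`. [folklore] -/
theorem farLog_bracket48 (hL : 48 ≤ L) :
    Real.log L / (2 * Real.pi) - 0.348041
        ≤ 1 / (4 * Real.pi) * Real.log ((1 + Real.sqrt (1 - Real.sin (Real.pi * (4 : ℕ) / L) ^ 4))
            / Real.sin (Real.pi * (4 : ℕ) / L) ^ 2) ∧
      1 / (4 * Real.pi) * Real.log ((1 + Real.sqrt (1 - Real.sin (Real.pi * (4 : ℕ) / L) ^ 4))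
            / Real.sin (Real.pi * (4 : ℕ) / L) ^ 2)
        ≤ Real.log L / (2 * Real.pi) - 0.345825 := by
  have hπlo := Real.pi_gt_d6
  have hπhi := Real.pi_lt_d6
  have hπ := Real.pi_pos
  have hL0 : (0 : ℝ) < L := by exact_mod_cast (show 0 < L by omega)
  have hL64 : (48 : ℝ) ≤ L := by exact_mod_cast hL
  have hs0 : 0 < Real.sin (Real.pi * (4 : ℕ) / L) := sin_row_pos L 4 (by norm_num) (by omega)
  set s := Real.sin (Real.pi * (4 : ℕ) / L) with hsdef
  set x := Real.pi * (4 : ℕ) / L with hxdef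
  have hx0 : 0 < x := by positivity
  have hx1 : x ≤ 1 := by rw [hxdef, div_le_one hL0]; push_cast; nlinarith
  have hxhi : x ≤ 3.141593 * 4 / 48 := by
    rw [hxdef, div_le_div_iff₀ hL0 (by norm_num)]; push_cast; nlinarith
  have hy4 : x ^ 2 ≤ 0.068539 := (pow_le_pow_left₀ hx0.le hxhi 2).trans (by norm_num)
  have hslo : x - x ^ 3 / 6 < s := Real.sin_gt_sub_cube hx0
  have hshi : s ≤ x := Real.sin_le hx0.le
  have hfac : 0 < 1 - x ^ 2 / 6 := by nlinarith
  have hsx : x * (1 - x ^ 2 / 6) ≤ s := by nlinarith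
  have hs1 : s < 1 := by nlinarith
  have hs4 : s ^ 4 < 1 := pow_lt_one₀ hs0.le hs1 (by norm_num)
  have hs40 : 0 ≤ s ^ 4 := by positivity
  have hsq1 : Real.sqrt (1 - s ^ 4) ≤ 1 := Real.sqrt_le_one.mpr (by linarith)
  have hsqlo : 1 - s ^ 4 ≤ Real.sqrt (1 - s ^ 4) := by
    have h1 : 0 ≤ 1 - s ^ 4 := by linarith
    have h2 : (1 - s ^ 4) ^ 2 ≤ 1 - s ^ 4 := by
      have := mul_le_mul_of_nonneg_left (show 1 - s ^ 4 ≤ 1 by linarith) h1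
      nlinarith
    calc 1 - s ^ 4 = Real.sqrt ((1 - s ^ 4) ^ 2) := (Real.sqrt_sq h1).symm
      _ ≤ Real.sqrt (1 - s ^ 4) := Real.sqrt_le_sqrt h2
  have hsq0 : 0 ≤ Real.sqrt (1 - s ^ 4) := Real.sqrt_nonneg _
  have hlog_split : Real.log ((1 + Real.sqrt (1 - s ^ 4)) / s ^ 2)
      = Real.log (1 + Real.sqrt (1 - s ^ 4)) - 2 * Real.log s := by
    rw [Real.log_div (by linarith) (by positivity), Real.log_pow]; push_cast; ring
  have hA_hi : Real.log (1 + Real.sqrt (1 - s ^ 4)) ≤ Real.log 2 :=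
    Real.log_le_log (by linarith) (by linarith)
  have hA_lo : Real.log 2 - s ^ 4 ≤ Real.log (1 + Real.sqrt (1 - s ^ 4)) := by
    have h2 : Real.log (2 - s ^ 4) ≤ Real.log (1 + Real.sqrt (1 - s ^ 4)) :=
      Real.log_le_log (by linarith) (by linarith)
    have hpos : (0 : ℝ) < 1 - s ^ 4 / 2 := by linarith
    have h4 : Real.log (2 - s ^ 4) = Real.log 2 + Real.log (1 - s ^ 4 / 2) := by
      rw [← Real.log_mul (by norm_num) hpos.ne']; congr 1; ring
    have h5 := Real.one_sub_inv_le_log_of_pos hpos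
    have h7 : (1 - s ^ 4 / 2)⁻¹ ≤ 1 + s ^ 4 := by
      rw [inv_eq_one_div, div_le_iff₀ hpos]
      nlinarith [mul_nonneg hs40 (sub_nonneg.mpr hs4.le)]
    linarith
  have hB_lo : -2 * Real.log x ≤ -2 * Real.log s := by
    have := Real.log_le_log hs0 hshi; linarith
  have hB_hi : -2 * Real.log s ≤ -2 * Real.log x + x ^ 2 / (3 * (1 - x ^ 2 / 6)) := by
    have h1 : Real.log (x * (1 - x ^ 2 / 6)) ≤ Real.log s := Real.log_le_log (by positivity) hsx
    rw [Real.log_mul hx0.ne' hfac.ne'] at h1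
    have h2 := Real.one_sub_inv_le_log_of_pos hfac
    have h6ne : (6 : ℝ) - x ^ 2 ≠ 0 := by nlinarith
    have h3 : 1 - (1 - x ^ 2 / 6)⁻¹ = -(x ^ 2 / (6 * (1 - x ^ 2 / 6))) := by
      rw [inv_eq_one_div]; field_simp; ring
    have h4 : x ^ 2 / (3 * (1 - x ^ 2 / 6)) = 2 * (x ^ 2 / (6 * (1 - x ^ 2 / 6))) := by
      field_simp; ring
    rw [h4]; linarith
  have hlogx : Real.log x = 2 * Real.log 2 + Real.log Real.pi - Real.log L := by
    rw [hxdef]; push_cast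
    rw [Real.log_div (by positivity) hL0.ne', Real.log_mul (by positivity) (by norm_num),
      show (4 : ℝ) = 2 ^ 2 by norm_num, Real.log_pow]
    push_cast; ring
  have hl2lo := Real.log_two_gt_d9
  have hl2hi := Real.log_two_lt_d9
  have hlπlo := Literature.Analysis.SpecialFunctions.Real.log_pi_gt_d20
  have hlπhi := Literature.Analysis.SpecialFunctions.Real.log_pi_lt_d20
  have hcorr_hi : x ^ 2 / (3 * (1 - x ^ 2 / 6)) ≤ 0.023112 := by
    rw [div_le_iff₀ (by positivity)]; nlinarith
  have hx4 : s ^ 4 ≤ 0.004698 := by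
    have : s ^ 2 ≤ x ^ 2 := pow_le_pow_left₀ hs0.le hshi 2
    nlinarith
  have hinv : 0 ≤ 1 / (4 * Real.pi) := by positivity
  have e2 : Real.log L / (2 * Real.pi) = 1 / (4 * Real.pi) * (2 * Real.log L) := by
    field_simp; ring
  rw [hlog_split, e2]
  constructor
  · -- lower: `LOGSUM ≥ 2 log L − K`, `K/(4π) ≤ 0.347785`
    have hnum : 2 * Real.log L - 4.3736 ≤ Real.log (1 + Real.sqrt (1 - s ^ 4)) - 2 * Real.log s := by
      rw [hlogx] at hB_lo; linarith only [hB_lo, hA_lo, hx4, hl2hi, hlπhi]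
    have h3 := mul_le_mul_of_nonneg_left hnum hinv
    have h4π : 0 < 4 * Real.pi := by positivity
    have hK : 4.3736 * (1 / (4 * Real.pi)) ≤ 0.348041 := by
      rw [← div_eq_mul_one_div, div_le_iff₀ h4π]; linarith only [hπlo]
    have e3 : 1 / (4 * Real.pi) * (2 * Real.log L - 4.3736)
        = 1 / (4 * Real.pi) * (2 * Real.log L) - 4.3736 * (1 / (4 * Real.pi)) := by ring
    linarith only [h3, hK, e3]
  · -- upper: `LOGSUM ≤ 2 log L − K'`, `K'/(4π) ≥ 0.3466356`
    have hnum : Real.log (1 + Real.sqrt (1 - s ^ 4)) - 2 * Real.log s ≤ 2 * Real.log L - 4.345789 := by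
      rw [hlogx] at hB_hi; linarith only [hB_hi, hA_hi, hcorr_hi, hl2lo, hlπlo]
    have h3 := mul_le_mul_of_nonneg_left hnum hinv
    have h4π : 0 < 4 * Real.pi := by positivity
    have hK : 0.345825 ≤ 4.345789 * (1 / (4 * Real.pi)) := by
      rw [← div_eq_mul_one_div, le_div_iff₀ h4π]; linarith only [hπhi]
    have e3 : 1 / (4 * Real.pi) * (2 * Real.log L - 4.345789)
        = 1 / (4 * Real.pi) * (2 * Real.log L) - 4.345789 * (1 / (4 * Real.pi)) := by ring
    linarith only [h3, hK, e3]

omit [NeZero L] in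
/-- the one-sided trapezoid remainder of the far rows, divided by `L`: `≤ 0.001448` for `L ≥ 48`. [folklore] -/
theorem farRemainder_bound48 (hL : 48 ≤ L) :
    0 ≤ Real.pi / (2 * L) * ((Real.sin (Real.pi * (4 : ℕ) / L) * Real.cos (Real.pi * (4 : ℕ) / L)
          * (1 + 2 * Real.sin (Real.pi * (4 : ℕ) / L) ^ 2))
        / (8 * (Real.sin (Real.pi * (4 : ℕ) / L) ^ 2 * (1 + Real.sin (Real.pi * (4 : ℕ) / L) ^ 2))
          * Real.sqrt (Real.sin (Real.pi * (4 : ℕ) / L) ^ 2 * (1 + Real.sin (Real.pi * (4 : ℕ) / L) ^ 2)))) / L ∧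
    Real.pi / (2 * L) * ((Real.sin (Real.pi * (4 : ℕ) / L) * Real.cos (Real.pi * (4 : ℕ) / L)
          * (1 + 2 * Real.sin (Real.pi * (4 : ℕ) / L) ^ 2))
        / (8 * (Real.sin (Real.pi * (4 : ℕ) / L) ^ 2 * (1 + Real.sin (Real.pi * (4 : ℕ) / L) ^ 2))
          * Real.sqrt (Real.sin (Real.pi * (4 : ℕ) / L) ^ 2 * (1 + Real.sin (Real.pi * (4 : ℕ) / L) ^ 2)))) / L
      ≤ 0.001448 := by
  have hπlo := Real.pi_gt_d6
  have hπhi := Real.pi_lt_d6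
  have hπ := Real.pi_pos
  have hL0 : (0 : ℝ) < L := by exact_mod_cast (show 0 < L by omega)
  have hL64 : (48 : ℝ) ≤ L := by exact_mod_cast hL
  have hs0 : 0 < Real.sin (Real.pi * (4 : ℕ) / L) := sin_row_pos L 4 (by norm_num) (by omega)
  set s := Real.sin (Real.pi * (4 : ℕ) / L) with hsdef
  set c := Real.cos (Real.pi * (4 : ℕ) / L) with hcdef
  set x := Real.pi * (4 : ℕ) / L with hxdef
  have hx0 : 0 < x := by positivity
  have hx1 : x ≤ 1 := by rw [hxdef, div_le_one hL0]; push_cast; nlinarith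
  have hxhi : x ≤ 3.141593 * 4 / 48 := by
    rw [hxdef, div_le_div_iff₀ hL0 (by norm_num)]; push_cast; nlinarith
  have hy4 : x ^ 2 ≤ 0.068539 := (pow_le_pow_left₀ hx0.le hxhi 2).trans (by norm_num)
  have hslo : x - x ^ 3 / 6 < s := Real.sin_gt_sub_cube hx0
  have hshi : s ≤ x := Real.sin_le hx0.le
  have hfac : 0 < 1 - x ^ 2 / 6 := by nlinarith
  have hsx : x * (1 - x ^ 2 / 6) ≤ s := by nlinarith
  have hc0 : 0 ≤ c := Real.cos_nonneg_of_mem_Icc ⟨by linarith, by linarith [Real.pi_gt_three]⟩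
  have hc1 : c ≤ 1 := Real.cos_le_one _
  have hP : 0 < s ^ 2 * (1 + s ^ 2) := by positivity
  set D : ℝ := (s * c * (1 + 2 * s ^ 2)) / (8 * (s ^ 2 * (1 + s ^ 2)) * Real.sqrt (s ^ 2 * (1 + s ^ 2)))
    with hDdef
  have hD0 : 0 ≤ D := by positivity
  refine ⟨by positivity, ?_⟩
  have hsqP : s ≤ Real.sqrt (s ^ 2 * (1 + s ^ 2)) := by
    have e : s = Real.sqrt (s ^ 2) := (Real.sqrt_sq hs0.le).symm
    conv_lhs => rw [e]
    exact Real.sqrt_le_sqrt (by nlinarith)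
  -- `D ≤ (1 + 2s²)/(8 s²)`
  have hD : D ≤ (1 + 2 * s ^ 2) / (8 * s ^ 2) := by
    rw [hDdef, div_le_div_iff₀ (by positivity) (by positivity)]
    have hA0 : 0 ≤ s * (1 + 2 * s ^ 2) * (8 * s ^ 2) := by positivity
    have h1 : s * c * (1 + 2 * s ^ 2) * (8 * s ^ 2) ≤ s * (1 + 2 * s ^ 2) * (8 * s ^ 2) := by
      have := mul_le_mul_of_nonneg_left hc1 hA0
      nlinarith
    have h2 : s ≤ (1 + s ^ 2) * Real.sqrt (s ^ 2 * (1 + s ^ 2)) := by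
      have h21 : s ≤ (1 + s ^ 2) * s := by nlinarith [sq_nonneg s]
      have h22 : (1 + s ^ 2) * s ≤ (1 + s ^ 2) * Real.sqrt (s ^ 2 * (1 + s ^ 2)) :=
        mul_le_mul_of_nonneg_left hsqP (by positivity)
      linarith
    have h3 : s * (1 + 2 * s ^ 2) * (8 * s ^ 2)
        ≤ (1 + 2 * s ^ 2) * (8 * (s ^ 2 * (1 + s ^ 2)) * Real.sqrt (s ^ 2 * (1 + s ^ 2))) := by
      have := mul_le_mul_of_nonneg_left h2 (show 0 ≤ (1 + 2 * s ^ 2) * (8 * s ^ 2) by positivity)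
      nlinarith
    linarith
  -- `(1+2s²)/(8s²) ≤ (1 + 2x²)/(8 (x(1 − x²/6))²)`
  have hD2 : (1 + 2 * s ^ 2) / (8 * s ^ 2) ≤ (1 + 2 * x ^ 2) / (8 * (x * (1 - x ^ 2 / 6)) ^ 2) := by
    have hsx2 : (x * (1 - x ^ 2 / 6)) ^ 2 ≤ s ^ 2 := pow_le_pow_left₀ (by positivity) hsx 2
    have hss : s ^ 2 ≤ x ^ 2 := pow_le_pow_left₀ hs0.le hshi 2
    rw [div_le_div_iff₀ (by positivity) (by positivity)]
    have h1 : (1 + 2 * s ^ 2) * (8 * (x * (1 - x ^ 2 / 6)) ^ 2) ≤ (1 + 2 * s ^ 2) * (8 * s ^ 2) :=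
      mul_le_mul_of_nonneg_left (by linarith) (by positivity)
    have h2 : (1 + 2 * s ^ 2) * (8 * s ^ 2) ≤ (1 + 2 * x ^ 2) * (8 * s ^ 2) :=
      mul_le_mul_of_nonneg_right (by linarith) (by positivity)
    linarith
  have hpre : Real.pi / (2 * L) * ((1 + 2 * x ^ 2) / (8 * (x * (1 - x ^ 2 / 6)) ^ 2)) / L
      = (1 + 2 * x ^ 2) / (256 * Real.pi * (1 - x ^ 2 / 6) ^ 2) := by
    rw [hxdef]; push_cast; field_simp; ring
  have hfin : (1 + 2 * x ^ 2) / (256 * Real.pi * (1 - x ^ 2 / 6) ^ 2) ≤ 0.001448 := by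
    rw [div_le_iff₀ (by positivity)]
    have h1 : (1 - 0.068539 / 6) ^ 2 ≤ (1 - x ^ 2 / 6) ^ 2 :=
      pow_le_pow_left₀ (by norm_num) (by linarith) 2
    have h2 : 0.001448 * (256 * 3.141592 * (1 - 0.068539 / 6) ^ 2)
        ≤ 0.001448 * (256 * Real.pi * (1 - x ^ 2 / 6) ^ 2) := by
      apply mul_le_mul_of_nonneg_left _ (by norm_num)
      exact mul_le_mul (by nlinarith) h1 (by positivity) (by positivity)
    nlinarith
  calc Real.pi / (2 * L) * D / L
      ≤ Real.pi / (2 * L) * ((1 + 2 * x ^ 2) / (8 * (x * (1 - x ^ 2 / 6)) ^ 2)) / L := by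
        apply div_le_div_of_nonneg_right _ hL0.le
        exact mul_le_mul_of_nonneg_left (hD.trans hD2) (by positivity)
    _ = _ := hpre
    _ ≤ 0.001448 := hfin

end CapacityConst

end Summit.HubbardSuperconductivity.HubbardSuperconductivity.Theorems.AnisotropyChord.Transfer.Fibre3

end
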